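import Mathlib.AlgebraicGeometry.ResidueField
import Mathlib.FieldTheory.Galois.Infinite
import HarnessLib

/-!
# A Galois-fixed `Ω`-point of a scheme descends to the ground field ([GortzWedhorn2020] Prop. 5.4 / (4.12); [StacksProject] Tag 01J9)

Layer `Literature/AlgebraicGeometry/Morphisms`, namespace `Literature.AlgebraicGeometry.Morphisms`.  THEOREMS ONLY (no definition, no named fact, no
instance, no notation).  For a Galois extension `Ω ⊇ κ` (e.g. `Ω = κ̄`, `char κ = 0`), a scheme `X` and an `Ω`-valued point `y : Spec Ω → X`:

* `descResidueField_comp_algEquiv_eq` — if `Spec σ ≫ y = y` for `σ ∈ Gal(Ω∕κ)` then the residue-field embedding `κ(y(pt)) → Ω` of `y` (Mathlib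
  `Scheme.SpecToEquivOfField`: `y = Spec (κ(h) → Ω) ≫ ι_h`) is fixed by `σ`;
* **`exists_specMap_algebraMap_comp_eq_of_forall_algEquiv`** — if `Spec σ ≫ y = y` for ALL `σ ∈ Gal(Ω∕κ)` then `y` is defined over `κ`:
  `y = Spec (κ → Ω) ≫ y₀` for some `y₀ : Spec κ → X` (the embedding lands in the fixed field `Ω^{Gal} = κ`, Mathlib `InfiniteGalois.mem_bot_iff_fixed`);
* `eq_of_specMap_comp_eq` — `Spec ι ≫ f = Spec ι ≫ g ⟹ f = g` for `f g : Spec κ → X` and a field map `ι : κ → Ω` (so `y₀` is unique).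

Purpose (cell `hodgecm-mathlib`, F-3 (Mc) spine, N3′ step S-f «descent `κ̄ → κ(t)` of the level-0 graph point»): generic input (D2).  HC_CM is proved only
modulo the 7 printed citations until rung 0 closes; nothing here bears on a summit statement.

## References
* [GortzWedhorn2020] U. Görtz, T. Wedhorn, *Algebraic Geometry I*, 2nd ed. (2020), Prop. 5.4 (p. 123) (`X(K)` = points with an embedding of the residue
  field) and Section (3.4) (p. 71).
* [StacksProject] The Stacks project, Tag 01J9 (points of schemes with values in a field).
-/

set_option autoImplicit false

noncomputable section

open CategoryTheory AlgebraicGeometry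

universe u

namespace Literature.AlgebraicGeometry.Morphisms

variable {κ Ω : Type u} [Field κ] [Field Ω] [Algebra κ Ω] {X : Scheme.{u}} (y : Spec (.of Ω) ⟶ X)

/-- `Spec σ ≫ Spec φ ≫ ι_h = Spec (φ ≫ σ) ≫ ι_h`: composing an `Ω`-point, presented as `Spec (κ(h) → Ω) ≫ ι_h`, with `Spec` of a ring
automorphism `σ` of `Ω` changes the residue-field embedding to `σ ∘ φ`. [cite: GortzWedhorn2020, Section (3.4) (p. 71)] -/
theorem specMap_comp_eq_symm_apply (σ : Ω ≃ₐ[κ] Ω) :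
    Spec.map (CommRingCat.ofHom σ.toAlgHom.toRingHom) ≫ y =
      (Scheme.SpecToEquivOfField Ω X).symm ⟨y (IsLocalRing.closedPoint Ω),
        X.descResidueField (Scheme.stalkClosedPointTo y) ≫ CommRingCat.ofHom σ.toAlgHom.toRingHom⟩ := by
  rw [Scheme.SpecToEquivOfField_symm_apply, Spec.map_comp, Category.assoc,
    Scheme.descResidueField_stalkClosedPointTo_fromSpecResidueField]

/-- **The residue-field embedding of a `σ`-fixed point is `σ`-fixed**: if `Spec σ ≫ y = y` then `σ ∘ φ_y = φ_y` for the embedding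
`φ_y : κ(y(pt)) → Ω`. [cite: GortzWedhorn2020, Prop. 5.4 (p. 123)] -/
theorem descResidueField_comp_algEquiv_eq (σ : Ω ≃ₐ[κ] Ω) (hy : Spec.map (CommRingCat.ofHom σ.toAlgHom.toRingHom) ≫ y = y) :
    X.descResidueField (Scheme.stalkClosedPointTo y) ≫ CommRingCat.ofHom σ.toAlgHom.toRingHom =
      X.descResidueField (Scheme.stalkClosedPointTo y) := by
  have h1 := specMap_comp_eq_symm_apply y σ
  rw [hy] at h1
  -- `y = E.symm ⟨h, φ⟩` as well, so the two dependent pairs agree (`E.symm` is injective)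
  have h0 : (Scheme.SpecToEquivOfField Ω X).symm ⟨y (IsLocalRing.closedPoint Ω),
      X.descResidueField (Scheme.stalkClosedPointTo y)⟩ = y := by
    rw [Scheme.SpecToEquivOfField_symm_apply, Scheme.descResidueField_stalkClosedPointTo_fromSpecResidueField]
  have h2 := (Scheme.SpecToEquivOfField Ω X).symm.injective (h0.trans h1)
  exact (eq_of_heq (Sigma.mk.inj h2).2).symm

/-- **A Galois-fixed `Ω`-point descends to `κ`.**  For `Ω ⊇ κ` Galois (e.g. `Ω` an algebraic closure of a field `κ` of characteristic `0`) and
`y : Spec Ω → X` with `Spec σ ≫ y = y` for every `σ ∈ Gal(Ω∕κ)`, there is `y₀ : Spec κ → X` with `y = Spec(κ → Ω) ≫ y₀`: the residue-field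
embedding of `y` is `Gal`-invariant, so lands in `Ω^{Gal(Ω∕κ)} = κ` (Mathlib `InfiniteGalois.mem_bot_iff_fixed`).
[cite: GortzWedhorn2020, Prop. 5.4 (p. 123)] [cite: StacksProject, Tag 01J9] -/
theorem exists_specMap_algebraMap_comp_eq_of_forall_algEquiv [IsGalois κ Ω]
    (hy : ∀ σ : Ω ≃ₐ[κ] Ω, Spec.map (CommRingCat.ofHom σ.toAlgHom.toRingHom) ≫ y = y) :
    ∃ y₀ : Spec (.of κ) ⟶ X, Spec.map (CommRingCat.ofHom (algebraMap κ Ω)) ≫ y₀ = y := by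
  classical
  set h := y (IsLocalRing.closedPoint Ω) with hh
  set φ : X.residueField h ⟶ CommRingCat.of Ω := X.descResidueField (Scheme.stalkClosedPointTo y) with hφ
  -- every value of `φ` is `Gal`-fixed, hence in `κ`
  have hfix : ∀ r : X.residueField h, φ.hom r ∈ (⊥ : IntermediateField κ Ω) := by
    intro r
    rw [InfiniteGalois.mem_bot_iff_fixed]
    intro σ
    have e := descResidueField_comp_algEquiv_eq y σ (hy σ)
    exact congrArg (fun (k : X.residueField h ⟶ CommRingCat.of Ω) => k.hom r) e
  -- factor `φ` through `κ`
  let φ₁ : X.residueField h →+* (⊥ : IntermediateField κ Ω) := φ.hom.codRestrict (⊥ : IntermediateField κ Ω) hfix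
  let φ₀ : X.residueField h →+* κ := (IntermediateField.botEquiv κ Ω).toRingEquiv.toRingHom.comp φ₁
  have hφ₀ : ∀ r, algebraMap κ Ω (φ₀ r) = φ.hom r := by
    intro r
    change algebraMap κ Ω (algebraMap (⊥ : IntermediateField κ Ω) κ (φ₁ r)) = _
    rw [← IsScalarTower.algebraMap_apply (⊥ : IntermediateField κ Ω) κ Ω (φ₁ r)]
    rfl
  refine ⟨Spec.map (CommRingCat.ofHom φ₀) ≫ X.fromSpecResidueField h, ?_⟩
  have hcomp : CommRingCat.ofHom φ₀ ≫ CommRingCat.ofHom (algebraMap κ Ω) = φ := by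
    ext r
    exact hφ₀ r
  rw [← Category.assoc, ← Spec.map_comp, hcomp, hφ, Scheme.descResidueField_stalkClosedPointTo_fromSpecResidueField]

omit [Algebra κ Ω] in
/-- **`Spec` of a field extension is right-cancellable on field-valued points**: for fields `κ → Ω` (any ring map `ι`), a scheme `X` and
`f g : Spec κ → X` with `Spec ι ≫ f = Spec ι ≫ g`, `f = g` — a `κ`-point is a point `h` with an embedding `κ(h) → κ`, and post-composing the
embedding with the injective `ι` loses nothing (Mathlib `Scheme.SpecToEquivOfField`). [cite: GortzWedhorn2020, Prop. 5.4 (p. 123)] [cite: StacksProject, Tag 01J9] -/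
theorem eq_of_specMap_comp_eq (ι : κ →+* Ω) (f g : Spec (.of κ) ⟶ X)
    (h : Spec.map (CommRingCat.ofHom ι) ≫ f = Spec.map (CommRingCat.ofHom ι) ≫ g) : f = g := by
  -- present `f`, `g` through the equivalence
  have hf : Spec.map (CommRingCat.ofHom ι) ≫ f = (Scheme.SpecToEquivOfField Ω X).symm
      ⟨f (IsLocalRing.closedPoint κ), X.descResidueField (Scheme.stalkClosedPointTo f) ≫ CommRingCat.ofHom ι⟩ := by
    rw [Scheme.SpecToEquivOfField_symm_apply, Spec.map_comp, Category.assoc,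
      Scheme.descResidueField_stalkClosedPointTo_fromSpecResidueField]
  have hg : Spec.map (CommRingCat.ofHom ι) ≫ g = (Scheme.SpecToEquivOfField Ω X).symm
      ⟨g (IsLocalRing.closedPoint κ), X.descResidueField (Scheme.stalkClosedPointTo g) ≫ CommRingCat.ofHom ι⟩ := by
    rw [Scheme.SpecToEquivOfField_symm_apply, Spec.map_comp, Category.assoc,
      Scheme.descResidueField_stalkClosedPointTo_fromSpecResidueField]
  have h2 := (Scheme.SpecToEquivOfField Ω X).symm.injective (hf.symm.trans (h.trans hg))
  obtain ⟨hpt, hemb⟩ := Sigma.mk.inj h2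
  -- same point, and the embeddings agree after the monomorphism `ι`
  have key : (⟨f (IsLocalRing.closedPoint κ), X.descResidueField (Scheme.stalkClosedPointTo f)⟩ :
      Σ x, X.residueField x ⟶ CommRingCat.of κ) =
      ⟨g (IsLocalRing.closedPoint κ), X.descResidueField (Scheme.stalkClosedPointTo g)⟩ := by
    rw [Scheme.SpecToEquivOfField_eq_iff]
    refine ⟨hpt, ?_⟩
    have hι : Function.Injective (CommRingCat.ofHom ι).hom := ι.injective
    haveI : Mono (CommRingCat.ofHom ι) := ConcreteCategory.mono_of_injective _ hι
    rw [← cancel_mono (CommRingCat.ofHom ι), Category.assoc]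
    -- transport `hemb` along the point identification
    have := (Scheme.SpecToEquivOfField_eq_iff (f₁ := ⟨f (IsLocalRing.closedPoint κ),
      X.descResidueField (Scheme.stalkClosedPointTo f) ≫ CommRingCat.ofHom ι⟩)
      (f₂ := ⟨g (IsLocalRing.closedPoint κ), X.descResidueField (Scheme.stalkClosedPointTo g) ≫ CommRingCat.ofHom ι⟩)).1 h2
    obtain ⟨e, he⟩ := this
    exact he
  have := congrArg (Scheme.SpecToEquivOfField κ X).symm key
  rwa [Scheme.SpecToEquivOfField_symm_apply, Scheme.SpecToEquivOfField_symm_apply,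
    Scheme.descResidueField_stalkClosedPointTo_fromSpecResidueField,
    Scheme.descResidueField_stalkClosedPointTo_fromSpecResidueField] at this

end Literature.AlgebraicGeometry.Morphisms

end
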